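import Summits.CriticalPhenomena.PercolationContinuityZ3.Theorems.Transplant.AutCylinderInduction
import Summits.CriticalPhenomena.PercolationContinuityZ3.Theorems.Transplant.AutEndStateOrbitQuasi
import Summits.CriticalPhenomena.PercolationContinuityZ3.Theorems.Transplant.CayleyNilpotentVirtuallyCyclic
import Summits.CriticalPhenomena.PercolationContinuityZ3.Theorems.Transplant.CubicLatticesCylinder
import HarnessLib

/-!
# Φ2 for class C2 by induction on the growth degree, part III: FREE COCOMPACT ACTIONS — finite generation by the neighbour sections, the section calculus
# along edges, `θ = 0` below `1` when the group is virtually cyclic (Lipschitz height), and the END-STATE INPUT from two independent characters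
# (the group embedded in `Aut(G)`); the Trofimov-free form of the induction for NILPOTENT groups is part IV («AutCylinderNilpotent»)

builds on p205010 (kernel theorem, internal audit signed; external expert review pending) — nothing in this file uses p205010; nothing here is a claim about any open
node (the only percolation statement, `theta_eq_zero_of_free_zpowers_finiteIndex`, is unconditional).  Lane `prim-bschramm`, seat `prim-bschramm-p3` gen 29 (DESIGN
OWNER).  Helper file (`--supports stmt-CriticalPhenomena-4575 --as helper`); def-free.

SETTING.  `A` acts on the connected locally finite graph `G` by automorphisms, FREELY (`a • w = w ⇒ a = 1`), with a finite transversal `reps`.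
* §1 `closure_nbSec_eq_top` — `A` is generated by the finite set `nbSec` of sections of the neighbours of the representatives (g28's `AutChart.closure_osec_eq_top` with
  trivial stabilisers); `osec_eq_mul_of_adj` — along an edge `x ∼ y` the sections differ by an element of `nbSec` on the right; `preimage_osec_subset` — the fibres of
  the section map have at most `|reps|` points.
* §2 **`theta_eq_zero_of_free_zpowers_finiteIndex`** — if `⟨c⟩` has finite index in `A` then `θ_x(p) = 0` for every `p < 1` (finite `A`: finite graph; otherwise the
  Lipschitz height `w ↦` exponent of `c` in `osec w = c^h ρ`, finite bands — p4 gen 22's Cayley argument «CayleyVirtuallyCyclicCriticalProbOne» transported by the section).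
* §3 `exists_indep_of_free_not_virtuallyCyclic` (NILPOTENT `A`, not virtually cyclic ⇒ two independent characters, gen 22's Milnor–Wolf lemma on the generating set
  of §1) and **`exists_endStateInput_of_free`** — the end-state input of `BenjaminiSchramm1996_conj4_endState` on `G`: `A₀ = ι(A) ≤ Aut(G)` (`ι a = (a • ·)`,
  injective by freeness), `c = (ψ₀, ψ₁) ∘ ι⁻¹`, the same `reps`; returned WITH the isomorphism `e : A ≃* A₀` and `(e a) w = a • w`, so that `A₀`-equivariant charts
  are `A`-equivariant (the form parts I–II consume).
[cite: BenjaminiSchramm1996, §2 (almost transitive graphs; Cayley graphs); Conj. 1] [cite: MilnorSolvableGrowth1968, Lemma 1] [cite: LyonsPeres2016, §7.4 Cor. 7.19]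
-/

noncomputable section

namespace Summit.CriticalPhenomena.PercolationContinuityZ3.Theorems.Transplant

namespace AutCyl

open SimpleGraph Literature.Barriers.CriticalPhenomena Literature.Probability.LatticeModels Literature.Probability.Percolation
open scoped Classical

variable {V : Type} {G : SimpleGraph V} {A : Type} [Group A] [MulAction A V] {reps : Finset V}

/-! ## §1 Free cocompact actions: generation and the section calculus -/

/-- The finite set of sections of the neighbours of the representatives. [folklore] -/
def nbSec (G : SimpleGraph V) [G.LocallyFinite] (reps : Finset V) (hcover : ∀ w : V, ∃ a : A, ∃ r ∈ reps, a • r = w) : Finset A :=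
  reps.biUnion fun ρ => (G.neighborFinset ρ).image (AutChart.osec hcover)

/-- Under a free action every stabiliser is trivial. [folklore] -/
theorem stabilizer_eq_bot (hfree : ∀ (a : A) (w : V), a • w = w → a = 1) (r : V) : MulAction.stabilizer A r = ⊥ := by
  rw [Subgroup.eq_bot_iff_forall]
  intro a ha
  exact hfree a r (MulAction.mem_stabilizer_iff.1 ha)

/-- **A free action with finitely many orbits on a connected locally finite graph is generated by the neighbour sections** (finite generation).
[cite: BenjaminiSchramm1996, §2 (almost transitive graphs)] -/
theorem closure_nbSec_eq_top [G.LocallyFinite] (hact : IsActionByAut G A) (hc : G.Connected) (hfree : ∀ (a : A) (w : V), a • w = w → a = 1)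
    (hcover : ∀ w : V, ∃ a : A, ∃ r ∈ reps, a • r = w) (htrans : ∀ r ∈ reps, ∀ r' ∈ reps, ∀ a : A, a • r = r' → r = r') {r : V} (hr : r ∈ reps) :
    Subgroup.closure (↑(nbSec G reps hcover : Finset A) : Set A) = ⊤ := by
  have h := AutChart.closure_osec_eq_top hact hc hcover htrans hr
  rw [stabilizer_eq_bot hfree r, Subgroup.coe_bot, Subgroup.closure_union, Subgroup.closure_singleton_one, sup_bot_eq] at h
  exact h

/-- **Section calculus along an edge**: for `x ∼ y`, `osec y = osec x * s` with `s ∈ nbSec` (the section of the neighbour `(osec x)⁻¹ • y` of the type of `x`).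
[folklore] -/
theorem osec_eq_mul_of_adj [G.LocallyFinite] (hact : IsActionByAut G A) (hfree : ∀ (a : A) (w : V), a • w = w → a = 1)
    (hcover : ∀ w : V, ∃ a : A, ∃ r ∈ reps, a • r = w) (htrans : ∀ r ∈ reps, ∀ r' ∈ reps, ∀ a : A, a • r = r' → r = r') {x y : V} (hxy : G.Adj x y) :
    ∃ s ∈ nbSec G reps hcover, AutChart.osec hcover y = AutChart.osec hcover x * s := by
  set b := AutChart.osec hcover x with hb
  set u := b⁻¹ • y with hu
  have hadj : G.Adj (AutChart.otyp hcover x) u := by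
    have h1 : G.Adj (b⁻¹ • x) (b⁻¹ • y) := (hact b⁻¹ x y).2 hxy
    have e0 : b⁻¹ • x = AutChart.otyp hcover x := by rw [inv_smul_eq_iff, hb, AutChart.osec_smul]
    rwa [e0] at h1
  refine ⟨AutChart.osec hcover u, Finset.mem_biUnion.2 ⟨AutChart.otyp hcover x, AutChart.otyp_mem hcover x,
    Finset.mem_image_of_mem _ ((G.mem_neighborFinset _ _).2 hadj)⟩, ?_⟩
  -- both sides carry `typ y` to `y`
  have htyp : AutChart.otyp hcover u = AutChart.otyp hcover y := by rw [hu, AutChart.otyp_smul hcover htrans]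
  have h1 : (b * AutChart.osec hcover u) • AutChart.otyp hcover y = y := by
    rw [mul_smul, ← htyp, AutChart.osec_smul hcover u, hu, smul_inv_smul]
  have h2 : AutChart.osec hcover y • AutChart.otyp hcover y = y := AutChart.osec_smul hcover y
  have h3 : ((AutChart.osec hcover y)⁻¹ * (b * AutChart.osec hcover u)) • AutChart.otyp hcover y = AutChart.otyp hcover y := by
    rw [mul_smul, h1, inv_smul_eq_iff]
    exact h2.symm
  have h4 := hfree _ _ h3
  rw [inv_mul_eq_one] at h4
  exact h4

/-- The fibres of the section map lie in a translate of the transversal. [folklore] -/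
theorem preimage_osec_subset (hcover : ∀ w : V, ∃ a : A, ∃ r ∈ reps, a • r = w) (g : A) :
    (AutChart.osec hcover) ⁻¹' {g} ⊆ (fun r => g • r) '' (reps : Set V) := by
  intro w hw
  rw [Set.mem_preimage, Set.mem_singleton_iff] at hw
  exact ⟨AutChart.otyp hcover w, AutChart.otyp_mem hcover w, by rw [← hw]; exact AutChart.osec_smul hcover w⟩

/-! ## §2 Virtually cyclic free cocompact actions: no percolation below `1` -/

/-- **A graph with a free cocompact action of a VIRTUALLY CYCLIC group does not percolate below `1`**: if `⟨c⟩` has finite index in `A` then `θ_x(p) = 0` for every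
`p < 1` and every vertex `x`. [cite: BenjaminiSchramm1996, §2 Conj. 1] [cite: LyonsPeres2016, §7.4 Cor. 7.19] -/
theorem theta_eq_zero_of_free_zpowers_finiteIndex [G.LocallyFinite] (hact : IsActionByAut G A) (hc : G.Connected)
    (hfree : ∀ (a : A) (w : V), a • w = w → a = 1) (hcover : ∀ w : V, ∃ a : A, ∃ r ∈ reps, a • r = w)
    (htrans : ∀ r ∈ reps, ∀ r' ∈ reps, ∀ a : A, a • r = r' → r = r') (c : A) (hcA : (Subgroup.zpowers c).FiniteIndex) (x : V) (p : unitInterval)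
    (hp : (p : ℝ) < 1) : theta G x p = 0 := by
  haveI : Countable V := countable_of_connected_of_locallyFinite G hc x
  haveI := hcA
  set H : Subgroup A := Subgroup.zpowers c with hH
  by_cases hfin : IsOfFinOrder c
  · -- finite group, finite graph
    haveI : Finite H := by
      have h1 : Nat.card H ≠ 0 := by rw [hH, Nat.card_zpowers]; exact hfin.orderOf_pos.ne'
      exact Nat.finite_of_card_ne_zero h1
    haveI : Finite A := VirtCyc.finite_of_finiteIndex_of_finite H (Set.toFinite _)
    haveI : Finite V := by
      refine Finite.of_surjective (fun q : A × (reps : Set V) => q.1 • (q.2 : V)) fun w => ?_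
      obtain ⟨a, r, hr, hw⟩ := hcover w
      exact ⟨(a, ⟨r, hr⟩), hw⟩
    have hpc : criticalProb G x = 1 := criticalProb_eq_one_of_finite G x
    exact theta_eq_zero_of_lt_criticalProb_holds G x p (by rw [hpc]; exact hp)
  · -- the height: exponent of `c` in the section
    have hinj : Function.Injective fun n : ℤ => c ^ n := injective_zpow_iff_not_isOfFinOrder.2 hfin
    let ρ : A → A := fun γ => ((QuotientGroup.mk (γ⁻¹) : A ⧸ H).out)⁻¹
    have hη : ∀ γ : A, γ * (ρ γ)⁻¹ ∈ H := fun γ => by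
      obtain ⟨k, hk⟩ := QuotientGroup.mk_out_eq_mul H γ⁻¹
      show γ * (((QuotientGroup.mk (γ⁻¹) : A ⧸ H).out)⁻¹)⁻¹ ∈ H
      rw [inv_inv, hk, mul_inv_cancel_left]
      exact k.2
    have hρ : ∀ γ γ' : A, γ * γ'⁻¹ ∈ H → ρ γ = ρ γ' := fun γ γ' h => by
      show ((QuotientGroup.mk (γ⁻¹) : A ⧸ H).out)⁻¹ = ((QuotientGroup.mk (γ'⁻¹) : A ⧸ H).out)⁻¹
      have e : (QuotientGroup.mk (γ⁻¹) : A ⧸ H) = QuotientGroup.mk (γ'⁻¹) := by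
        rw [QuotientGroup.eq, inv_inv]; exact h
      rw [e]
    have hex : ∀ γ : A, ∃ k : ℤ, c ^ k = γ * (ρ γ)⁻¹ := fun γ => Subgroup.mem_zpowers_iff.1 (hη γ)
    choose h hh using hex
    have hdec : ∀ γ : A, γ = c ^ h γ * ρ γ := fun γ => by rw [hh, inv_mul_cancel_right]
    have hstep : ∀ γ s : A, h (γ * s) = h γ + h (ρ γ * s) := fun γ s => by
      have hρs : ρ (γ * s) = ρ (ρ γ * s) := hρ _ _ (by
        rw [mul_inv_rev, ← mul_assoc, mul_assoc γ, mul_inv_cancel, mul_one]; exact hη γ)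
      apply hinj
      show c ^ h (γ * s) = c ^ (h γ + h (ρ γ * s))
      rw [zpow_add, hh, hh, hh, hρs]
      group
    set R : Finset A := (Set.finite_range fun q : A ⧸ H => (q.out)⁻¹).toFinset with hR
    have hρR : ∀ γ, ρ γ ∈ R := fun γ => by rw [hR, Set.Finite.mem_toFinset]; exact ⟨_, rfl⟩
    set T : Finset A := nbSec G reps hcover with hT
    set L : ℕ := ∑ r ∈ R, ∑ s ∈ T, (h (r * s)).natAbs with hL
    have hLb : ∀ r ∈ R, ∀ s ∈ T, (h (r * s)).natAbs ≤ L := fun r hr s hs =>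
      (Finset.single_le_sum (f := fun s => (h (r * s)).natAbs) (fun _ _ => Nat.zero_le _) hs).trans
        (Finset.single_le_sum (f := fun r => ∑ s ∈ T, (h (r * s)).natAbs) (fun _ _ => Nat.zero_le _) hr)
    -- the height of a vertex = the height of its section
    refine theta_eq_zero_of_lipschitzHeight G x (fun w => h (AutChart.osec hcover w)) L ?_ (fun R₀ => (2 * R₀ + 1) * R.card * reps.card) ?_ p hp
    · intro u w huw
      obtain ⟨s, hs, he⟩ := osec_eq_mul_of_adj hact hfree hcover htrans huw
      show |h (AutChart.osec hcover u) - h (AutChart.osec hcover w)| ≤ L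
      rw [he, hstep, show h (AutChart.osec hcover u) - (h (AutChart.osec hcover u) + h (ρ (AutChart.osec hcover u) * s)) =
        -h (ρ (AutChart.osec hcover u) * s) by ring, abs_neg, Int.abs_eq_natAbs]
      exact_mod_cast hLb _ (hρR _) _ hs
    · intro a R₀
      refine ⟨((Finset.Icc (a - R₀) (a + R₀) ×ˢ R) ×ˢ reps).image fun q => (c ^ q.1.1 * q.1.2) • q.2, ?_, fun v hv => ?_⟩
      · refine Finset.card_image_le.trans ?_
        rw [Finset.card_product, Finset.card_product, Int.card_Icc]
        gcongr
        omega
      · rw [abs_le] at hv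
        refine Finset.mem_image.2 ⟨((h (AutChart.osec hcover v), ρ (AutChart.osec hcover v)), AutChart.otyp hcover v),
          Finset.mem_product.2 ⟨Finset.mem_product.2 ⟨Finset.mem_Icc.2 ⟨by linarith, by linarith⟩, hρR _⟩, AutChart.otyp_mem hcover v⟩, ?_⟩
        show (c ^ h (AutChart.osec hcover v) * ρ (AutChart.osec hcover v)) • AutChart.otyp hcover v = v
        rw [← hdec, AutChart.osec_smul]

/-! ## §3 Nilpotent free cocompact actions: characters and the end-state input -/

/-- **A NILPOTENT group acting freely with finitely many orbits on a connected locally finite graph, not virtually cyclic, has two INDEPENDENT characters**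
(Milnor–Wolf on the neighbour sections). [cite: MilnorSolvableGrowth1968, Lemma 1] -/
theorem exists_indep_of_free_not_virtuallyCyclic [G.LocallyFinite] [Group.IsNilpotent A] (hact : IsActionByAut G A) (hc : G.Connected)
    (hfree : ∀ (a : A) (w : V), a • w = w → a = 1) (hcover : ∀ w : V, ∃ a : A, ∃ r ∈ reps, a • r = w)
    (htrans : ∀ r ∈ reps, ∀ r' ∈ reps, ∀ a : A, a • r = r' → r = r') (hne : reps.Nonempty) (hnvc : ¬ ∃ c : A, (Subgroup.zpowers c).FiniteIndex) :
    ∃ (ψ₀ ψ₁ : A →* Multiplicative ℤ) (a b : A),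
      Multiplicative.toAdd (ψ₀ a) * Multiplicative.toAdd (ψ₁ b) ≠ Multiplicative.toAdd (ψ₁ a) * Multiplicative.toAdd (ψ₀ b) := by
  obtain ⟨r, hr⟩ := hne
  have hgen := closure_nbSec_eq_top hact hc hfree hcover htrans hr
  rw [Nilpotent.virtuallyCyclic_iff_dependent _ hgen] at hnvc
  push Not at hnvc
  exact hnvc

/-- **THE END-STATE INPUT from a free cocompact action with two independent characters**: the group embeds into `Aut(G)` as `A₀` (with an isomorphism `e` acting as
the given action), the character `(ψ₀, ψ₁) ∘ e⁻¹` kills every (trivial) stabiliser and has rank two; the covering transversal is `reps` itself.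
[cite: BenjaminiSchramm1996, §2 (almost transitive graphs; Cayley graphs)] -/
theorem exists_endStateInput_of_free (hact : IsActionByAut G A) (hfree : ∀ (a : A) (w : V), a • w = w → a = 1)
    (hcover : ∀ w : V, ∃ a : A, ∃ r ∈ reps, a • r = w) (hne : reps.Nonempty) (ψ₀ ψ₁ : A →* Multiplicative ℤ) (a b : A)
    (hind : Multiplicative.toAdd (ψ₀ a) * Multiplicative.toAdd (ψ₁ b) ≠ Multiplicative.toAdd (ψ₁ a) * Multiplicative.toAdd (ψ₀ b)) :
    ∃ (A₀ : Subgroup (G ≃g G)) (e : A ≃* A₀) (c : A₀ →* Multiplicative (Site 2)),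
      (∀ (g : A) (w : V), ((e g : A₀) : G ≃g G) w = g • w) ∧ (∀ g : A, c (e g) = CayleyScaled.pairHom ψ₀ ψ₁ g) ∧
      (∀ w : V, ∃ x : A₀, ∃ s ∈ reps, (x : G ≃g G) s = w) ∧ (∀ (x : A₀) (w : V), (x : G ≃g G) w = w → c x = 1) ∧
      ∃ x y : A₀, MaxArea.det2 (Multiplicative.toAdd (c x)) (Multiplicative.toAdd (c y)) ≠ 0 := by
  obtain ⟨r₀, hr₀⟩ := hne
  -- the action as a homomorphism into `Aut(G)`
  let ι : A →* (G ≃g G) :=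
    { toFun := fun g => smulIso hact g
      map_one' := RelIso.ext fun w => by show (1 : A) • w = w; exact one_smul A w
      map_mul' := fun g g' => RelIso.ext fun w => by show (g * g') • w = g • g' • w; exact mul_smul g g' w }
  have hι : ∀ (g : A) (w : V), ι g w = g • w := fun g w => rfl
  have hιinj : Function.Injective ι := fun g g' hgg => by
    have h1 := congrArg (fun f : G ≃g G => f r₀) hgg
    simp only [hι] at h1
    have h2 : (g'⁻¹ * g) • r₀ = r₀ := by rw [mul_smul, h1, inv_smul_smul]
    have h3 := hfree _ _ h2
    rw [inv_mul_eq_one] at h3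
    exact h3.symm
  set A₀ : Subgroup (G ≃g G) := ι.range with hA₀
  let e : A ≃* A₀ := MonoidHom.ofInjective hιinj
  have he : ∀ g : A, ((e g : A₀) : G ≃g G) = ι g := fun g => MonoidHom.ofInjective_apply hιinj
  let c : A₀ →* Multiplicative (Site 2) := (CayleyScaled.pairHom ψ₀ ψ₁).comp e.symm.toMonoidHom
  have hc : ∀ g : A, c (e g) = CayleyScaled.pairHom ψ₀ ψ₁ g := fun g => by
    show CayleyScaled.pairHom ψ₀ ψ₁ (e.symm (e g)) = _; rw [MulEquiv.symm_apply_apply]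
  refine ⟨A₀, e, c, fun g w => by rw [he, hι], hc, fun w => ?_, fun x w hxw => ?_, ?_⟩
  · obtain ⟨g, s, hs, hw⟩ := hcover w
    exact ⟨e g, s, hs, by rw [he, hι, hw]⟩
  · have hx : x = e (e.symm x) := (MulEquiv.apply_symm_apply e x).symm
    have h1 : (e.symm x : A) • w = w := by
      have h2 : ((e (e.symm x) : A₀) : G ≃g G) w = w := by rw [← hx]; exact hxw
      rwa [he, hι] at h2
    rw [hx, hc, hfree _ _ h1, map_one]
  · refine ⟨e a, e b, ?_⟩
    rw [hc, hc, MaxArea.det2, CayleyScaled.toAdd_pairHom_zero, CayleyScaled.toAdd_pairHom_one, CayleyScaled.toAdd_pairHom_zero,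
      CayleyScaled.toAdd_pairHom_one]
    exact sub_ne_zero.2 hind

end AutCyl

end Summit.CriticalPhenomena.PercolationContinuityZ3.Theorems.Transplant

end
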